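import Summits.NavierStokesRegularity.FunctionalMining.NoGo.TopEigHeatCoerciveOne
import Summits.NavierStokesRegularity.FunctionalMining.NoGo.TopEigLaminateHeatLine
import Summits.NavierStokesRegularity.FunctionalMining.NoGo.TopBotEigHeatWindow
import HarnessLib

/-!
# FunctionalMining / NoGo — K33b: the LAMINATE CEILING on Lemma L-λ's constant for every real `q > 1`:
# `C_λ(q) ≤ R_λ(q) := 36π²q(q − 1)/(3q − 1) ≤ 18π²(q − 1)`, hence `C_λ(q) → 0 = C_λ(1)` as `q ↓ 1`

HONEST FRAMING. Search for candidate a priori estimates; no regularity claim. Nothing about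
Navier–Stokes is proved or asserted in this file: it evaluates the dictionary's STATIC heat-line
functionals (`heatDissipation Φ v = sup_{t>0} (Φ(v) − Φ(v + tΔv))/t`, `TopEigHeatCoercive.lean`; no transport,
no pressure) along the heat line of ONE explicit smooth divergence-free zero-mean field of `T³` and books the
outcome against `C_λ(q) = TopEig.topEigHeatRate q` (kernel window `[0, 4π²q]`, `TopEigHeatRate.lean`) and
against K6's symmetrised constant `C_λ^sym(q) = topBotEigHeatRate q` (`NoGo/TopBotEigHeatWindow.lean`).
Cell `pub-nsfunc`, no-go seat (gen 45); sequel of K32 (`NoGo/TopEigHeatCoerciveOne.lean`, `C_λ(1) = 0`) and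
of K33a (`NoGo/TopEigLaminateHeatLine.lean`: line formula, Bernoulli, Wallis moments `I(a) = sinAbsMoment a`). [ours]

THE WITNESS is K32's laminate `u_F = (F(x₂), 0, 0)`, `F′ = sin³(2π·) =: S³` (`sinCubePrim`):
* §1 `sinCubePrim_DDD`, `sinCubePrim_line` — `F‴ = 12π²S(2 − 3S²)`, so `F′ + tF‴ = S·(S² + t(24π² − 36π²S²))`;
  with K33a's tangent-form Bernoulli, POINTWISE for every real `t` and `q ≥ 1` (`line_rpow_ge`):
  `|F′ + tF‴|^q ≥ |S|^{3q} + t·q·|S|^{3q−2}(24π² − 36π²S²)`;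
* §2 integrating over `[0,1]` and using K33a's recursion `I(3q − 2) = 3q·I(3q)/(3q − 1)`:
  **`integral_line_drop_le : ∫₀¹|F′|^q − ∫₀¹|F′ + tF‴|^q ≤ t·R_λ(q)·∫₀¹|F′|^q` for EVERY real `t`** (`q > 1`),
  `R_λ(q) = lamRate q := 36π²q(q − 1)/(3q − 1)`; so every difference quotient of the heat line of
  `Φ_q = ∫(λ₁⁺)^q` (and of `Ψ_q = ∫((−λ₃)⁺)^q`) at `u_F` is `≤ R_λ(q)·Φ_q(u_F)` (`moment_drop_le`, K33a §1–§2);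
* §3 BOOKING (`topEigHeatRate_le_ratio`, K6 `topBotEigHeatRate_le_ratio`; `Φ_q(u_F) = 2^{−q}I(3q) > 0`):
  **`topEigHeatRate_le_lamRate : C_λ(q) ≤ R_λ(q)`**, `negBotEigHeatRate_le_lamRate`,
  **`topBotEigHeatRate_le_lamRate : C_λ^sym(q) ≤ R_λ(q)`** (every real `q > 1`);
  **`topEigHeatRate_le_linear : C_λ(q) ≤ 18π²(q − 1)`** and `topBotEigHeatRate_le_linear` (every real `q ≥ 1`;
  the endpoint is K32), `topBotEigHeatRate_one : C_λ^sym(1) = 0`, the windows `C_λ(q) ∈ [0, min(4π²q, 18π²(q−1))]`,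
  `C_λ^sym(q) ∈ [C_λ(q), min(4π²q, 18π²(q−1))]`, and **`tendsto_topEigHeatRate_one`,
  `tendsto_topBotEigHeatRate_one`: `C_λ(q), C_λ^sym(q) → 0` as `q ↓ 1`** (right-continuity at the endpoint);
  `lamRate_lt_poincare_iff : R_λ(q) < 4π²q ↔ q < 4/3` — the laminate ceiling beats the tree's Poincaré
  ceiling `4π²q` exactly on `[1, 4/3)` (`R_λ(4/3) = 16π²/3 = 4π²·4/3`).

SCOPE, EXACTLY: UPPER bounds on `C_λ(q)` and `C_λ^sym(q)` only. No lower bound is proved: Lemma L-λ(q)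
(`C_λ(q) > 0`) stays OPEN in the kernel for every real `q > 1` (pen-FALSE for `q ≥ 2`, NOGO.md §1/§7, not in
the kernel), and the laminate is NOT a kill for `q > 1` — its exact heat price is `2^{−q}q(q−1)∫₀¹|F′|^{q−2}F″² > 0`
(pen; `R_λ(q)·Φ_q(u_F)` is that price, the bound being the Bernoulli linearisation, sharp to first order in `t`).
Nothing about `q < 1`. PROVENANCE / STATUS. Typed by the no-go seat (gen 45); farm-checked at CONCAT grade
(K32 ++ K33a ++ this body under their TREE imports: `lean check` rc 0, 0 sorries, 0 warnings; axioms standard);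
pen note `pub-nsfunc-nogo/sieveld/lamq1/LAMINATE-Q1-NOTE.md` §3. STATUS: STAGED (files after K32 and K33a).
FILING (prove seat g27, REQUEST #50): declarations byte-identical to the no-go seat's staged `TopEigHeatLaminateCeiling.STAGING.lean` 3fc9af3b3d775006; this line is the only addition.
-/

noncomputable section

open MeasureTheory Set intervalIntegral Real
open scoped ContDiff Topology

namespace Summit.NavierStokesRegularity.FunctionalMining

open Literature.Analysis Literature.Analysis.FunctionSpaces Literature.Analysis.FunctionSpaces.Torus
open TopEig PlanarTopEig StrainL4 LaminateDirection
open Literature.Analysis.FluidPDE.LeiZhang2011 (abs_rpow_mul_sq) -- landed [folklore] lemma, via K33aʼs import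

namespace TopEigLaminate

/-! ## 1. The witness profile `F′ = sin³(2π·)`: `F‴`, the factorised heat line, the pointwise bound -/

/-- **`F‴(s) = 12π² sin(2πs)(2 − 3 sin²(2πs))`** for the profile `sinCubePrim`. [ours] -/
theorem sinCubePrim_DDD (s : ℝ) :
    sinCubePrim.D.D.D s = 12 * π ^ 2 * sin (2 * π * s) * (2 - 3 * sin (2 * π * s) ^ 2) := by
  have hS := hasDerivAt_sin_two_pi_mul s
  have hC := hasDerivAt_cos_two_pi_mul s
  rw [ShearProfile.D_apply, show (sinCubePrim.D.D : ℝ → ℝ) = fun s =>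
      6 * π * sin (2 * π * s) ^ 2 * cos (2 * π * s) from funext sinCubePrim_DD,
    (((hS.fun_pow 2).const_mul (6 * π)).fun_mul hC).deriv]
  simp only [Nat.cast_ofNat, Nat.add_one_sub_one, pow_one]
  have h := sin_sq_add_cos_sq (2 * π * s)
  linear_combination (24 * π ^ 2 * sin (2 * π * s)) * h

/-- **The heat line of the witness factorises**: `F′ + tF‴ = sin(2πs)·(sin²(2πs) + t(24π² − 36π² sin²(2πs)))`.
[ours; bookkeeping] -/
theorem sinCubePrim_line (t s : ℝ) :
    sinCubePrim.D s + t * sinCubePrim.D.D.D s =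
      sin (2 * π * s) * (sin (2 * π * s) ^ 2 + t * (24 * π ^ 2 - 36 * π ^ 2 * sin (2 * π * s) ^ 2)) := by
  rw [sinCubePrim_D, sinCubePrim_DDD]; ring

/-- **Pointwise bound along the heat line of the witness** (`q ≥ 1`, every real `t`, `S = sin(2πs)`):
`|S|^{3q} + t·q·|S|^{3q−2}·(24π² − 36π²S²) ≤ |F′(s) + tF‴(s)|^q`. [ours] -/
theorem line_rpow_ge (t s : ℝ) {q : ℝ} (hq : 1 ≤ q) :
    |sin (2 * π * s)| ^ (3 * q) +
        t * (q * (|sin (2 * π * s)| ^ (3 * q - 2) * (24 * π ^ 2 - 36 * π ^ 2 * sin (2 * π * s) ^ 2))) ≤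
      |sinCubePrim.D s + t * sinCubePrim.D.D.D s| ^ q := by
  set S := sin (2 * π * s) with hSdef
  have hb := tangent_le_abs_rpow (P := S ^ 2 + t * (24 * π ^ 2 - 36 * π ^ 2 * S ^ 2)) (sq_nonneg S) hq
  have hm := mul_le_mul_of_nonneg_left hb (rpow_nonneg (abs_nonneg S) q)
  rw [← mul_rpow (abs_nonneg S) (abs_nonneg _), ← abs_mul, ← sinCubePrim_line] at hm
  refine le_trans (le_of_eq ?_) hm
  have e1 : |S| ^ q * (S ^ 2) ^ q = |S| ^ (3 * q) := by
    rw [abs_rpow_mul_sq_rpow S (by linarith)]; ring_nf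
  have e2 : |S| ^ q * (S ^ 2) ^ (q - 1) = |S| ^ (3 * q - 2) := by
    rw [abs_rpow_mul_sq_rpow S (by linarith)]; ring_nf
  rw [mul_add, e1, show S ^ 2 + t * (24 * π ^ 2 - 36 * π ^ 2 * S ^ 2) - S ^ 2 =
    t * (24 * π ^ 2 - 36 * π ^ 2 * S ^ 2) by ring, show |S| ^ q * (q * (S ^ 2) ^ (q - 1) *
    (t * (24 * π ^ 2 - 36 * π ^ 2 * S ^ 2))) = t * (q * (|S| ^ q * (S ^ 2) ^ (q - 1) *
    (24 * π ^ 2 - 36 * π ^ 2 * S ^ 2))) by ring, e2]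

/-! ## 2. The integrated line bound for the witness and its heat-line drop -/

/-- **At `t = 0`: `∫₀¹ |F′|^q = I(3q)`** (`q` real). [ours; bookkeeping] -/
theorem integral_rpow_zero (q : ℝ) :
    ∫ s in (0 : ℝ)..1, |sinCubePrim.D s + 0 * sinCubePrim.D.D.D s| ^ q = sinAbsMoment (3 * q) := by
  refine intervalIntegral.integral_congr fun s _ => ?_
  rw [zero_mul, add_zero, sinCubePrim_D, abs_pow, ← rpow_natCast, ← rpow_mul (abs_nonneg _)]
  norm_num

/-- **Integrated line bound** (`q ≥ 1`, every real `t`):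
`I(3q) + t·q·(24π²·I(3q−2) − 36π²·I(3q)) ≤ ∫₀¹ |F′ + tF‴|^q`. [ours] -/
theorem integral_line_rpow_ge (t : ℝ) {q : ℝ} (hq : 1 ≤ q) :
    sinAbsMoment (3 * q) + t * (q * (24 * π ^ 2 * sinAbsMoment (3 * q - 2) - 36 * π ^ 2 * sinAbsMoment (3 * q))) ≤
      ∫ s in (0 : ℝ)..1, |sinCubePrim.D s + t * sinCubePrim.D.D.D s| ^ q := by
  have hf := continuous_abs_sin_rpow (a := 3 * q) (by linarith)
  have hg := continuous_abs_sin_rpow (a := 3 * q - 2) (by linarith)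
  have hint : IntervalIntegrable (fun s : ℝ => |sin (2 * π * s)| ^ (3 * q) +
      t * (q * (|sin (2 * π * s)| ^ (3 * q - 2) * (24 * π ^ 2 - 36 * π ^ 2 * sin (2 * π * s) ^ 2))))
      volume 0 1 :=
    (hf.add (continuous_const.mul (continuous_const.mul (hg.mul (by fun_prop))))).intervalIntegrable 0 1
  have hR : IntervalIntegrable (fun s : ℝ => |sinCubePrim.D s + t * sinCubePrim.D.D.D s| ^ q) volume 0 1 :=
    ((sinCubePrim.D.continuous.add (continuous_const.mul sinCubePrim.D.D.D.continuous)).abs.rpow_const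
      fun _ => Or.inr (by linarith)).intervalIntegrable 0 1
  refine le_trans (le_of_eq ?_) (intervalIntegral.integral_mono_on zero_le_one hint hR
    fun s _ => line_rpow_ge t s hq)
  have e : ∀ s : ℝ, |sin (2 * π * s)| ^ (3 * q) + t * (q * (|sin (2 * π * s)| ^ (3 * q - 2) *
      (24 * π ^ 2 - 36 * π ^ 2 * sin (2 * π * s) ^ 2))) = |sin (2 * π * s)| ^ (3 * q) +
      t * (q * (24 * π ^ 2 * |sin (2 * π * s)| ^ (3 * q - 2) - 36 * π ^ 2 * |sin (2 * π * s)| ^ (3 * q))) := by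
    intro s
    have h3 : |sin (2 * π * s)| ^ (3 * q - 2) * sin (2 * π * s) ^ 2 = |sin (2 * π * s)| ^ (3 * q) := by
      rw [abs_rpow_mul_sq _ (by linarith), show 3 * q - 2 + 2 = 3 * q by ring]
    rw [← h3]; ring
  simp_rw [e]
  unfold sinAbsMoment
  have hA : IntervalIntegrable (fun s : ℝ => |sin (2 * π * s)| ^ (3 * q)) volume 0 1 := hf.intervalIntegrable 0 1
  have hB : IntervalIntegrable (fun s : ℝ => 24 * π ^ 2 * |sin (2 * π * s)| ^ (3 * q - 2)) volume 0 1 :=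
    (hg.intervalIntegrable 0 1).const_mul _
  have hC : IntervalIntegrable (fun s : ℝ => 36 * π ^ 2 * |sin (2 * π * s)| ^ (3 * q)) volume 0 1 :=
    hA.const_mul _
  have hD : IntervalIntegrable (fun s : ℝ => t * (q * (24 * π ^ 2 * |sin (2 * π * s)| ^ (3 * q - 2) -
      36 * π ^ 2 * |sin (2 * π * s)| ^ (3 * q)))) volume 0 1 := ((hB.sub hC).const_mul q).const_mul t
  rw [intervalIntegral.integral_add hA hD, intervalIntegral.integral_const_mul, intervalIntegral.integral_const_mul,
    intervalIntegral.integral_sub hB hC, intervalIntegral.integral_const_mul, intervalIntegral.integral_const_mul]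

/-- **The laminate rate `R_λ(q) := 36π²q(q − 1)/(3q − 1)`.** [ours, bookkeeping] -/
def lamRate (q : ℝ) : ℝ := 36 * π ^ 2 * q * (q - 1) / (3 * q - 1)

/-- `R_λ(1) = 0`. [ours, bookkeeping] -/
theorem lamRate_one : lamRate 1 = 0 := by simp [lamRate]

/-- `0 ≤ R_λ(q)` for `q ≥ 1`. [ours, bookkeeping] -/
theorem lamRate_nonneg {q : ℝ} (hq : 1 ≤ q) : 0 ≤ lamRate q := by
  unfold lamRate
  exact div_nonneg (mul_nonneg (mul_nonneg (by positivity) (by linarith)) (by linarith)) (by linarith)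

/-- **`R_λ(q) ≤ 18π²(q − 1)`** for `q ≥ 1`. [ours, bookkeeping] -/
theorem lamRate_le_linear {q : ℝ} (hq : 1 ≤ q) : lamRate q ≤ 18 * π ^ 2 * (q - 1) := by
  unfold lamRate
  rw [div_le_iff₀ (by linarith)]
  nlinarith [pi_pos, mul_nonneg (mul_nonneg (sq_nonneg π) (sub_nonneg.2 hq)) (sub_nonneg.2 hq)]

/-- **`R_λ(q) < 4π²q ↔ q < 4/3`** (`q ≥ 1`): the laminate bound improves the tree's Poincaré ceiling
`C_λ(q) ≤ 4π²q` exactly on `[1, 4/3)`. [ours, bookkeeping] -/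
theorem lamRate_lt_poincare_iff {q : ℝ} (hq : 1 ≤ q) : lamRate q < 4 * π ^ 2 * q ↔ q < 4 / 3 := by
  unfold lamRate
  rw [div_lt_iff₀ (by linarith)]
  constructor
  · intro h; nlinarith [pi_pos, sq_nonneg π, mul_pos (mul_pos (pow_pos pi_pos 2) (by linarith : (0:ℝ) < q))
      (by linarith : (0:ℝ) < q)]
  · intro h; nlinarith [mul_pos (pow_pos pi_pos 2) (by linarith : (0:ℝ) < q)]

/-- **HEAT-LINE DROP of the witness, every real `q > 1` and every real `t`:**
`∫₀¹|F′|^q − ∫₀¹|F′ + tF‴|^q ≤ t · R_λ(q) · ∫₀¹|F′|^q`. [ours] -/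
theorem integral_line_drop_le (t : ℝ) {q : ℝ} (hq : 1 < q) :
    (∫ s in (0 : ℝ)..1, |sinCubePrim.D s + 0 * sinCubePrim.D.D.D s| ^ q) -
        ∫ s in (0 : ℝ)..1, |sinCubePrim.D s + t * sinCubePrim.D.D.D s| ^ q ≤
      t * (lamRate q * ∫ s in (0 : ℝ)..1, |sinCubePrim.D s + 0 * sinCubePrim.D.D.D s| ^ q) := by
  have h := integral_line_rpow_ge t hq.le
  have hrec := sinAbsMoment_rec_three hq
  rw [integral_rpow_zero]
  have e : sinAbsMoment (3 * q - 2) = 3 * q / (3 * q - 1) * sinAbsMoment (3 * q) := by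
    rw [div_mul_eq_mul_div, eq_div_iff (by linarith)]; linarith
  rw [e] at h
  have h3 : 3 * q - 1 ≠ 0 := ne_of_gt (by linarith)
  have e2 : t * (q * (24 * π ^ 2 * (3 * q / (3 * q - 1) * sinAbsMoment (3 * q)) -
      36 * π ^ 2 * sinAbsMoment (3 * q))) = -(t * (lamRate q * sinAbsMoment (3 * q))) := by
    have hX : (3 * q - 1) * (3 * q - 1)⁻¹ = 1 := mul_inv_cancel₀ h3
    unfold lamRate
    rw [div_eq_mul_inv, div_eq_mul_inv]
    linear_combination (t * (36 * π ^ 2 * q * sinAbsMoment (3 * q))) * hX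
  linarith

/-! ## 3. Booking: `C_λ(q) ≤ R_λ(q)`, `C_λ(q) ≤ 18π²(q − 1)`, the symmetrised constant, and `q ↓ 1` -/

/-- **`Φ_q(u_F) − Φ_q(u_F + tΔu_F) ≤ t·R_λ(q)·Φ_q(u_F)`** and the same for `Ψ_q` (`q > 1`, every `t`). [ours] -/
theorem moment_drop_le (t : ℝ) {q : ℝ} (hq : 1 < q) :
    torusTopEigMoment q (lamU sinCubePrim) -
          torusTopEigMoment q (lamU sinCubePrim + t • Torus.laplacian (lamU sinCubePrim)) ≤
        t * (lamRate q * torusTopEigMoment q (lamU sinCubePrim)) ∧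
      torusNegBotEigMoment q (lamU sinCubePrim) -
          torusNegBotEigMoment q (lamU sinCubePrim + t • Torus.laplacian (lamU sinCubePrim)) ≤
        t * (lamRate q * torusNegBotEigMoment q (lamU sinCubePrim)) := by
  have hq0 : 0 < q := by linarith
  obtain ⟨h0, h0'⟩ := topEigMoment_line_half sinCubePrim 0 hq0
  obtain ⟨ht, ht'⟩ := topEigMoment_line_half sinCubePrim t hq0
  rw [zero_smul, add_zero] at h0 h0'
  have hd := mul_le_mul_of_nonneg_left (integral_line_drop_le t hq) (le_of_lt (rpow_pos_of_pos
    (by norm_num : (0 : ℝ) < 1 / 2) q))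
  rw [h0, ht, h0', ht']
  constructor <;> nlinarith [hd]

/-- **`Φ_q(u_F) > 0`** and `Ψ_q(u_F) > 0` (`q > 0`). [ours; bookkeeping] -/
theorem moment_lamU_sinCubePrim_pos {q : ℝ} (hq : 0 < q) :
    0 < torusTopEigMoment q (lamU sinCubePrim) ∧ 0 < torusNegBotEigMoment q (lamU sinCubePrim) := by
  obtain ⟨h0, h0'⟩ := topEigMoment_line_half sinCubePrim 0 hq
  rw [zero_smul, add_zero, integral_rpow_zero] at h0 h0'
  have h := mul_pos (rpow_pos_of_pos (by norm_num : (0 : ℝ) < 1 / 2) q) (sinAbsMoment_pos (a := 3 * q)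
    (by linarith))
  exact ⟨h0 ▸ h, h0' ▸ h⟩

/-- **THEOREM (laminate ceiling). `C_λ(q) ≤ R_λ(q) = 36π²q(q − 1)/(3q − 1)` for every real `q > 1`.** [ours] -/
theorem topEigHeatRate_le_lamRate {q : ℝ} (hq : 1 < q) : topEigHeatRate q ≤ lamRate q := by
  have hΦ := (moment_lamU_sinCubePrim_pos (q := q) (by linarith)).1
  have h := topEigHeatRate_le_ratio hq.le (lamU sinCubePrim) (isSmooth_lamU _) (isDivFree_lamU _)
    hasZeroMean_lamU_sinCubePrim hΦ
  refine h.trans ((div_le_iff₀ hΦ).2 ?_)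
  exact heatDissipation_le_of_line fun t _ => (moment_drop_le t hq).1

/-- **`C_λ^−(q) ≤ R_λ(q)`** for every real `q > 1` (the bottom-eigenvalue constant; `C_λ^− = C_λ`). [ours] -/
theorem negBotEigHeatRate_le_lamRate {q : ℝ} (hq : 1 < q) : negBotEigHeatRate q ≤ lamRate q := by
  rw [negBotEigHeatRate_eq]; exact topEigHeatRate_le_lamRate hq

/-- **`C_λ^sym(q) ≤ R_λ(q)`** for every real `q > 1` (the symmetrised core `Φ_q + Ψ_q`, K6's window). [ours] -/
theorem topBotEigHeatRate_le_lamRate {q : ℝ} (hq : 1 < q) : topBotEigHeatRate q ≤ lamRate q := by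
  obtain ⟨hΦ, hΨ⟩ := moment_lamU_sinCubePrim_pos (q := q) (by linarith)
  have hpos : 0 < topBotEigMoment q (lamU sinCubePrim) := by
    unfold topBotEigMoment; exact add_pos hΦ hΨ
  have h := topBotEigHeatRate_le_ratio hq.le (lamU sinCubePrim) (isSmooth_lamU _) (isDivFree_lamU _)
    hasZeroMean_lamU_sinCubePrim hpos
  refine h.trans ((div_le_iff₀ hpos).2 ?_)
  unfold topBotEigMoment
  rw [mul_add]
  exact add_le_add (heatDissipation_le_of_line fun t _ => (moment_drop_le t hq).1)
    (heatDissipation_le_of_line fun t _ => (moment_drop_le t hq).2)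

/-- **`C_λ^sym(1) = 0`** (from K32's `¬TopBotEigHeatCoercivePos 1` and K6's dichotomy). [ours] -/
theorem topBotEigHeatRate_one : topBotEigHeatRate 1 = 0 :=
  (not_topBotEigHeatCoercivePos_iff_rate_eq_zero le_rfl).1 not_topBotEigHeatCoercivePos_one

/-- **LINEAR ENDPOINT LAW. `C_λ(q) ≤ 18π²(q − 1)` for every real `q ≥ 1`.** [ours] -/
theorem topEigHeatRate_le_linear {q : ℝ} (hq : 1 ≤ q) : topEigHeatRate q ≤ 18 * π ^ 2 * (q - 1) := by
  rcases hq.eq_or_lt with rfl | hq'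
  · rw [topEigHeatRate_one]; norm_num
  · exact (topEigHeatRate_le_lamRate hq').trans (lamRate_le_linear hq)

/-- **`C_λ^sym(q) ≤ 18π²(q − 1)`** for every real `q ≥ 1`. [ours] -/
theorem topBotEigHeatRate_le_linear {q : ℝ} (hq : 1 ≤ q) : topBotEigHeatRate q ≤ 18 * π ^ 2 * (q - 1) := by
  rcases hq.eq_or_lt with rfl | hq'
  · rw [topBotEigHeatRate_one]; norm_num
  · exact (topBotEigHeatRate_le_lamRate hq').trans (lamRate_le_linear hq)

/-- **KERNEL WINDOW NEAR `q = 1`: `C_λ(q) ∈ [0, min(4π²q, 18π²(q − 1))]`** (`q ≥ 1`). [ours] -/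
theorem topEigHeatRate_mem_Icc_near_one {q : ℝ} (hq : 1 ≤ q) :
    topEigHeatRate q ∈ Icc 0 (min (4 * π ^ 2 * q) (18 * π ^ 2 * (q - 1))) :=
  ⟨topEigHeatRate_nonneg hq, le_min (topEigHeatRate_le hq) (topEigHeatRate_le_linear hq)⟩

/-- **`C_λ^sym(q) ∈ [C_λ(q), min(4π²q, 18π²(q − 1))]`** (`q ≥ 1`). [ours] -/
theorem topBotEigHeatRate_mem_Icc_near_one {q : ℝ} (hq : 1 ≤ q) :
    topBotEigHeatRate q ∈ Icc (topEigHeatRate q) (min (4 * π ^ 2 * q) (18 * π ^ 2 * (q - 1))) :=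
  ⟨topEigHeatRate_le_topBotEigHeatRate hq, le_min (topBotEigHeatRate_le hq) (topBotEigHeatRate_le_linear hq)⟩

/-- **CONTINUITY AT THE ENDPOINT: `C_λ(q) → 0 = C_λ(1)` as `q ↓ 1`** (squeeze by `18π²(q − 1)`). [ours] -/
theorem tendsto_topEigHeatRate_one : Filter.Tendsto topEigHeatRate (𝓝[≥] 1) (𝓝 0) := by
  have h0 : Filter.Tendsto (fun q : ℝ => 18 * π ^ 2 * (q - 1)) (𝓝[≥] 1) (𝓝 0) := by
    have : Filter.Tendsto (fun q : ℝ => 18 * π ^ 2 * (q - 1)) (𝓝 1) (𝓝 (18 * π ^ 2 * (1 - 1))) :=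
      ((continuous_const.mul (continuous_id.sub continuous_const)).tendsto 1)
    rw [sub_self, mul_zero] at this
    exact this.mono_left nhdsWithin_le_nhds
  refine tendsto_of_tendsto_of_tendsto_of_le_of_le' tendsto_const_nhds h0 ?_ ?_
  · exact eventually_nhdsWithin_of_forall fun q hq => topEigHeatRate_nonneg hq
  · exact eventually_nhdsWithin_of_forall fun q hq => topEigHeatRate_le_linear hq

/-- **`C_λ^sym(q) → 0` as `q ↓ 1`.** [ours] -/
theorem tendsto_topBotEigHeatRate_one : Filter.Tendsto topBotEigHeatRate (𝓝[≥] 1) (𝓝 0) := by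
  have h0 : Filter.Tendsto (fun q : ℝ => 18 * π ^ 2 * (q - 1)) (𝓝[≥] 1) (𝓝 0) := by
    have : Filter.Tendsto (fun q : ℝ => 18 * π ^ 2 * (q - 1)) (𝓝 1) (𝓝 (18 * π ^ 2 * (1 - 1))) :=
      ((continuous_const.mul (continuous_id.sub continuous_const)).tendsto 1)
    rw [sub_self, mul_zero] at this
    exact this.mono_left nhdsWithin_le_nhds
  refine tendsto_of_tendsto_of_tendsto_of_le_of_le' tendsto_const_nhds h0 ?_ ?_
  · exact eventually_nhdsWithin_of_forall fun q hq => topBotEigHeatRate_nonneg hq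
  · exact eventually_nhdsWithin_of_forall fun q hq => topBotEigHeatRate_le_linear hq

end TopEigLaminate

end Summit.NavierStokesRegularity.FunctionalMining

end
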